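/-
Copyright: statement-level skeleton of a published paper (lit-balaban cell, Phase-2 proof seat p25, gen 21). No proof
claims beyond what the kernel checks below.
-/
import Literature.MathematicalPhysics.QuantumFieldTheory.BalabanImbrieJaffe1984to88.BIJ88WalkLocalCount312

/-!
# `BalabanImbrieJaffe1984to88.BIJ88WalkWeightedLocalitySupports` — T. Bałaban, J. Imbrie, A. Jaffe, *Effective action
and cluster properties of the abelian Higgs model*, Commun. Math. Phys. **114** (1988) 257–315 [BalabanImbrieJaffe1988],
§5.14 p. 310 [PDF 54], verbatim: *"We give random walk expansions for the propagators C^{(k)}_{Λ₁₂^{(k)}},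
C^{(k)}_{Λ₁₂^{(k)}}(u_{k+1}) produced in this step. The leading terms, with only propagators C^{(k)}_{Λ₁₂^{(k)},loc},
C^{(k)}_{Λ₁₂^{(k)},loc}(u_{k+1}), we transform further. The others, localized in region X, have a factor of
e^{−cr(e_k)|X|}. We also consider as remainders any terms whose order in λ and e is greater than n̄."* and (after the
W₆′ estimate) *"(We allow adjustments in β, α, β′, keeping them small.)"*, with Sect. 2 p. 264
[PDF 8]: *"The operator C^{(k)}_{Λ,X}(u) depends only on u in X. It vanishes unless both arguments are in X"* and p. 265:
*"Here and elsewhere, |X| refers to the number of r(e_k)-cubes in X, not the volume of X."* — **THE WEIGHTED LOCALITY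
OF THE INTERACTION FROM THE SUPPORTS OF THE COVARIANCE PIECES** (p25 gen 21; file W4a, a MEMBER of row C2.Claim@312,
owner r16, referee ref-5; head of record `BIJ88WalkIneq312RemainderBdry.ineq312_remainder_bdry` UNCHANGED).

Gen 21's weighted head `BIJ88WalkIneq312WeightedLocality.ineq312_remainder_bdry_W` takes the locality of the
interaction as two weighted sums over the covariance pieces `p` seen by a direction `u`:
`Σ_{p : C_p u ≠ 0} ρ_p ≤ ρ₀` and `Σ_p ρ_p·#{(m,j) : ⟨C_p u,(legs m)_j⟩ ≠ 0} ≤ ρ₁`.  This file derives both from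
GEOMETRIC data of the kind print's walk pieces carry: every piece `p` has a support `supp p` (a set of cubes) outside
which it neither reads nor writes (print: *"vanishes unless both arguments are in X"*), directions and vertex legs
live in single cubes with at most `L` vertex legs per cube, and the piece weights are summable over the pieces whose
support contains a given cube, plain (`ρ₀`) and with the multiplicity `|supp p|` (`ρ₁`; print: `Σ_X e^{−cr(e_k)|X|}|X|`):
then `hρ₀` holds with `ρ₀` and `hρN` with `L·ρ₁` — uniformly in the volume (`weighted_locality_of_supports`).  The
REACH form `weighted_locality_of_reach` covers print's local part `C_loc` as well (local by RANGE, not by region: for a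
direction in the cube `k` it writes only into the cubes `reach loc k` within its range): per direction cube `k`, the
piece `p` sees it iff `sees p k` and then writes into `reach p k`; the per-cube sums run over `{p : sees p k}` with the
multiplicity `|reach p k|`.

statement-level skeleton of published theorems with citation tags; proofs where landed; nothing here is a claim
about the Yang–Mills mass gap

PDF held: `paper:balaban1988-cmp114-bij-abelian-higgs-effective-action` (journal page = PDF page + 256); p. 310 = PDF
54, pp. 264–265 = PDF 8–9.

CITATION HEADER (lean-in-tree rule).  lit-balaban cell (HOME `run/shared/lean/pub/lit-balaban/`), Phase 2, seat p25
gen 21; row **C2.Claim@312** of `HOME/lit-balaban-r16/ROWS-C2-part2.md` (owner r16, referee ref-5; MEMBER).  USED BY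
NAME, nothing restated: Mathlib only (the hypotheses produced are literally those of
`BIJ88WalkLocalCountW312.run_lsum_le_W` / `BIJ88WalkIneq312WeightedLocality.ineq312_remainder_bdry_W`); the support
clause of (2.46) that a walk-piece instance would feed in is `BIJ88RandomWalk242.cX_support` (p13).

## What is proved (0 `sorry`, standard axioms, no new `Prop` facts; theorems only, no definitions)

* `pieces_seeing_le`, `coupled_legs_le` (the two pointwise facts), **`weighted_locality_of_supports`** (pieces local
  by REGION); `coupled_legs_le_of_support`, **`weighted_locality_of_reach`** (pieces local by region OR by range —
  print's `C_X` and `C_loc` —: `sees p k`, `reach p k` per direction cube).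
HONEST SCOPE: (a) combinatorics only — supports, cubes and weights are HYPOTHESES; no walk expansion, no covariance and
no weight `e^{−cr(e_k)|X|}` is constructed here; (b) directions supported in ONE cube (print's legs and observables are
local; a multi-cube direction is a sum of such); (c) the summability inputs `hρ₀`, `hρ₁` per cube are where print's
`e^{−cr(e_k)|X|}` and the count of connected `X ∋ □` enter — not proved here.  NOT summit progress; NOT continuum; NOT
Clay.  Imports `BIJ88WalkLocalCount312` (vocabulary only); modifies nothing.
-/

noncomputable section

namespace Literature.MathematicalPhysics.QuantumFieldTheory.BalabanImbrieJaffe1984to88.BIJ88WalkWeightedLocalitySupports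

open Classical Matrix Finset
open scoped BigOperators

variable {S : Type} [Fintype S] {ι : Type} [Fintype ι] {P : Type} [Fintype P] {K : Type}
  {cubeOf : S → K} {supp : P → Finset K} {Cov : P → Matrix S S ℝ} {legs : ι → List (S → ℝ)}
  {legCube : ι → ℕ → K} {Dir : Set (S → ℝ)}

omit [Fintype P] in
/-- **A PIECE SEEING A ONE-CUBE DIRECTION HAS THAT CUBE IN ITS SUPPORT**: if `C_p` annihilates every direction not
touching `supp p` and `u` lives in the cube `k`, then `C_p u ≠ 0 ⇒ k ∈ supp p`.
[cite: BalabanImbrieJaffe1988, Sect. 2 p.264 (support clause of (2.46)), §5.14 p.310] -/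
theorem pieces_seeing_le (hin : ∀ p u, Cov p *ᵥ u ≠ 0 → ∃ y, u y ≠ 0 ∧ cubeOf y ∈ supp p)
    {u : S → ℝ} {k : K} (hu : ∀ y, u y ≠ 0 → cubeOf y = k) {p : P} (hp : Cov p *ᵥ u ≠ 0) : k ∈ supp p := by
  obtain ⟨y, hy, hk⟩ := hin p u hp
  rwa [hu y hy] at hk

omit [Fintype P] in
/-- **THE VERTEX LEGS COUPLED TO A VECTOR LIE IN THE CUBES CARRYING IT**: if `v` is supported in the cubes `A`, each
vertex leg lives in one cube and at most `L` legs live in any cube, then `#{(m,j) : ⟨v,(legs m)_j⟩ ≠ 0} ≤ L·|A|`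
(print: *"|X| refers to the number of r(e_k)-cubes in X"*). [cite: BalabanImbrieJaffe1988, Sect. 2 p.264–265, §5.14 p.310] -/
theorem coupled_legs_le_of_support (hleg : ∀ m j x, ((legs m).getD j 0) x ≠ 0 → cubeOf x = legCube m j) {L : ℕ}
    (hL : ∀ k, (∑ m, ((range (legs m).length).filter fun j => legCube m j = k).card) ≤ L) {v : S → ℝ}
    (A : Finset K) (hv : ∀ x, v x ≠ 0 → cubeOf x ∈ A) :
    (∑ m, ((range (legs m).length).filter fun j => v ⬝ᵥ (legs m).getD j 0 ≠ 0).card) ≤ L * A.card := by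
  -- a coupled leg shares a site with `v`, hence lives in a cube of `A`
  have hsub : ∀ m, ((range (legs m).length).filter fun j => v ⬝ᵥ (legs m).getD j 0 ≠ 0)
      ⊆ (range (legs m).length).filter fun j => legCube m j ∈ A := by
    intro m j hj
    rw [Finset.mem_filter] at hj ⊢
    refine ⟨hj.1, ?_⟩
    obtain ⟨x, -, hx⟩ := Finset.exists_ne_zero_of_sum_ne_zero hj.2
    have h1 : v x ≠ 0 := fun h => hx (by rw [h, zero_mul])
    have h2 : ((legs m).getD j 0) x ≠ 0 := fun h => hx (by rw [h, mul_zero])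
    rw [← hleg m j x h2]
    exact hv x h1
  calc (∑ m, ((range (legs m).length).filter fun j => v ⬝ᵥ (legs m).getD j 0 ≠ 0).card)
      ≤ ∑ m, ((range (legs m).length).filter fun j => legCube m j ∈ A).card :=
        Finset.sum_le_sum fun m _ => Finset.card_le_card (hsub m)
    _ = ∑ m, ∑ k ∈ A, ((range (legs m).length).filter fun j => legCube m j = k).card := by
        refine Finset.sum_congr rfl fun m _ => ?_
        have hmaps : (((range (legs m).length).filter fun j => legCube m j ∈ A : Finset ℕ) : Set ℕ).MapsTo
            (fun j => legCube m j) (A : Set K) := fun j hj =>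
          Finset.mem_coe.2 (Finset.mem_filter.1 (Finset.mem_coe.1 hj)).2
        rw [Finset.card_eq_sum_card_fiberwise hmaps]
        refine Finset.sum_congr rfl fun k hk => ?_
        congr 1
        ext j
        simp only [Finset.mem_filter, Finset.mem_range]
        constructor
        · rintro ⟨⟨hj, -⟩, hjk⟩; exact ⟨hj, hjk⟩
        · rintro ⟨hj, hjk⟩; exact ⟨⟨hj, by rw [hjk]; exact hk⟩, hjk⟩
    _ = ∑ k ∈ A, ∑ m, ((range (legs m).length).filter fun j => legCube m j = k).card := Finset.sum_comm
    _ ≤ ∑ k ∈ A, L := Finset.sum_le_sum fun k _ => hL k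
    _ = L * A.card := by rw [Finset.sum_const, smul_eq_mul, mul_comm]

omit [Fintype P] in
/-- **THE VERTEX LEGS COUPLED TO `C_p u` LIE IN THE SUPPORT OF `p`**: if `C_p u` is supported in `supp p`, each vertex
leg lives in one cube and at most `L` legs live in any cube, then `#{(m,j) : ⟨C_p u,(legs m)_j⟩ ≠ 0} ≤ L·|supp p|`
(print: *"|X| refers to the number of r(e_k)-cubes in X"*). [cite: BalabanImbrieJaffe1988, Sect. 2 p.264–265, §5.14 p.310] -/
theorem coupled_legs_le (hout : ∀ p u x, (Cov p *ᵥ u) x ≠ 0 → cubeOf x ∈ supp p)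
    (hleg : ∀ m j x, ((legs m).getD j 0) x ≠ 0 → cubeOf x = legCube m j) {L : ℕ}
    (hL : ∀ k, (∑ m, ((range (legs m).length).filter fun j => legCube m j = k).card) ≤ L) (p : P) (u : S → ℝ) :
    (∑ m, ((range (legs m).length).filter fun j => (Cov p *ᵥ u) ⬝ᵥ (legs m).getD j 0 ≠ 0).card)
      ≤ L * (supp p).card :=
  coupled_legs_le_of_support hleg hL (supp p) (hout p u)

/-- **THE WEIGHTED LOCALITY OF THE INTERACTION FROM THE SUPPORTS OF THE PIECES**: pieces `p` with supports `supp p`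
outside which they neither read (`hin`) nor write (`hout`); directions in `Dir` living in one cube; vertex legs living
in one cube, at most `L` per cube; weights `ρ ≥ 0` with, for every cube `k`, `Σ_{p : k ∈ supp p} ρ_p ≤ ρ₀` and
`Σ_{p : k ∈ supp p} ρ_p·|supp p| ≤ ρ₁`.  Then for every `u ∈ Dir`:
`Σ_{p : C_p u ≠ 0} ρ_p ≤ ρ₀` and `Σ_p ρ_p·#{(m,j) : ⟨C_p u,(legs m)_j⟩ ≠ 0} ≤ L·ρ₁` — the hypotheses `hρ₀`, `hρN`
of `BIJ88WalkLocalCountW312.run_lsum_le_W` / `BIJ88WalkIneq312WeightedLocality.ineq312_remainder_bdry_W`, uniformly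
in the volume. [cite: BalabanImbrieJaffe1988, §5.14 p.310, Sect. 2 p.264–265] -/
theorem weighted_locality_of_supports (hin : ∀ p u, Cov p *ᵥ u ≠ 0 → ∃ y, u y ≠ 0 ∧ cubeOf y ∈ supp p)
    (hout : ∀ p u x, (Cov p *ᵥ u) x ≠ 0 → cubeOf x ∈ supp p) (hDir : ∀ u ∈ Dir, ∃ k, ∀ y, u y ≠ 0 → cubeOf y = k)
    (hleg : ∀ m j x, ((legs m).getD j 0) x ≠ 0 → cubeOf x = legCube m j) {L : ℕ}
    (hL : ∀ k, (∑ m, ((range (legs m).length).filter fun j => legCube m j = k).card) ≤ L)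
    {ρ : P → ℝ} (hρ : ∀ p, 0 ≤ ρ p) {ρ₀ ρ₁ : ℝ} (hρ₀ : ∀ k, (∑ p ∈ univ.filter (fun p => k ∈ supp p), ρ p) ≤ ρ₀)
    (hρ₁ : ∀ k, (∑ p ∈ univ.filter (fun p => k ∈ supp p), ρ p * (supp p).card) ≤ ρ₁) :
    (∀ u ∈ Dir, (∑ p ∈ univ.filter (fun p => Cov p *ᵥ u ≠ 0), ρ p) ≤ ρ₀) ∧
    (∀ u ∈ Dir, (∑ p, ρ p *
      ((∑ m, ((range (legs m).length).filter fun j => (Cov p *ᵥ u) ⬝ᵥ (legs m).getD j 0 ≠ 0).card : ℕ) : ℝ))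
        ≤ L * ρ₁) := by
  constructor
  · intro u hu
    obtain ⟨k, hk⟩ := hDir u hu
    have hsub : univ.filter (fun p => Cov p *ᵥ u ≠ 0) ⊆ univ.filter fun p => k ∈ supp p := fun p hp => by
      rw [Finset.mem_filter] at hp ⊢
      exact ⟨hp.1, pieces_seeing_le hin hk hp.2⟩
    exact (Finset.sum_le_sum_of_subset_of_nonneg hsub fun p _ _ => hρ p).trans (hρ₀ k)
  · intro u hu
    obtain ⟨k, hk⟩ := hDir u hu
    -- a piece not seeing `u` couples to no leg; a piece seeing `u` has `k` in its support
    have hz : ∀ p, Cov p *ᵥ u = 0 →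
        (∑ m, ((range (legs m).length).filter fun j => (Cov p *ᵥ u) ⬝ᵥ (legs m).getD j 0 ≠ 0).card) = 0 :=
      fun p hp => Finset.sum_eq_zero fun m _ => by
        rw [Finset.card_eq_zero, Finset.filter_eq_empty_iff]
        intro j _ h
        exact h (by rw [hp, zero_dotProduct])
    have hρ₁0 : 0 ≤ ρ₁ :=
      (Finset.sum_nonneg fun p _ => mul_nonneg (hρ p) (Nat.cast_nonneg _)).trans (hρ₁ k)
    calc ∑ p, ρ p * ((∑ m, ((range (legs m).length).filter
            fun j => (Cov p *ᵥ u) ⬝ᵥ (legs m).getD j 0 ≠ 0).card : ℕ) : ℝ)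
        = ∑ p ∈ univ.filter (fun p => Cov p *ᵥ u ≠ 0), ρ p * ((∑ m, ((range (legs m).length).filter
            fun j => (Cov p *ᵥ u) ⬝ᵥ (legs m).getD j 0 ≠ 0).card : ℕ) : ℝ) := by
          rw [Finset.sum_filter]
          refine Finset.sum_congr rfl fun p _ => ?_
          by_cases hp : Cov p *ᵥ u = 0
          · rw [if_neg (not_not.2 hp), hz p hp, Nat.cast_zero, mul_zero]
          · rw [if_pos hp]
      _ ≤ ∑ p ∈ univ.filter (fun p => Cov p *ᵥ u ≠ 0), ρ p * ((L : ℝ) * (supp p).card) :=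
          Finset.sum_le_sum fun p _ => mul_le_mul_of_nonneg_left
            (by exact_mod_cast coupled_legs_le hout hleg hL p u) (hρ p)
      _ ≤ ∑ p ∈ univ.filter (fun p => k ∈ supp p), ρ p * ((L : ℝ) * (supp p).card) :=
          Finset.sum_le_sum_of_subset_of_nonneg (fun p hp => by
              rw [Finset.mem_filter] at hp ⊢
              exact ⟨hp.1, pieces_seeing_le hin hk hp.2⟩)
            fun p _ _ => mul_nonneg (hρ p) (mul_nonneg (Nat.cast_nonneg _) (Nat.cast_nonneg _))
      _ = (L : ℝ) * ∑ p ∈ univ.filter (fun p => k ∈ supp p), ρ p * (supp p).card := by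
          rw [Finset.mul_sum]
          exact Finset.sum_congr rfl fun p _ => by ring
      _ ≤ L * ρ₁ := mul_le_mul_of_nonneg_left (hρ₁ k) (Nat.cast_nonneg _)

/-! ## Reach form: pieces local by RANGE (print's `C_loc`) as well as by REGION (print's `C_X`) -/

/-- **THE WEIGHTED LOCALITY OF THE INTERACTION FROM THE REACH OF THE PIECES** (both of print's kinds of pieces): for a
direction living in the cube `k`, the piece `p` SEES it only if `sees p k` and then writes only into the cubes
`reach p k` — for print's local part `C_loc` every cube is seen and `reach loc k` is the cubes within its range of `k`
(a bounded number), for a walk part `C_X` the cube is seen iff it lies in `X̃` and `reach X k = X̃` (*"vanishes unless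
both arguments are in X"*); vertex legs live in one cube, at most `L` per cube; weights `ρ ≥ 0` with, for every cube
`k`, `Σ_{p : sees p k} ρ_p ≤ ρ₀` and `Σ_{p : sees p k} ρ_p·|reach p k| ≤ ρ₁`.  Then for every `u ∈ Dir`:
`Σ_{p : C_p u ≠ 0} ρ_p ≤ ρ₀` and `Σ_p ρ_p·#{(m,j) : ⟨C_p u,(legs m)_j⟩ ≠ 0} ≤ L·ρ₁` — the hypotheses `hρ₀`, `hρN` of
`BIJ88WalkLocalCountW312.run_lsum_le_W`, uniformly in the volume. [cite: BalabanImbrieJaffe1988, §5.14 p.310, Sect. 2 p.264–265] -/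
theorem weighted_locality_of_reach {sees : P → K → Prop} {reach : P → K → Finset K}
    (hin : ∀ p (u : S → ℝ) k, (∀ y, u y ≠ 0 → cubeOf y = k) → Cov p *ᵥ u ≠ 0 → sees p k)
    (hout : ∀ p (u : S → ℝ) k, (∀ y, u y ≠ 0 → cubeOf y = k) → ∀ x, (Cov p *ᵥ u) x ≠ 0 → cubeOf x ∈ reach p k)
    (hDir : ∀ u ∈ Dir, ∃ k, ∀ y, u y ≠ 0 → cubeOf y = k)
    (hleg : ∀ m j x, ((legs m).getD j 0) x ≠ 0 → cubeOf x = legCube m j) {L : ℕ}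
    (hL : ∀ k, (∑ m, ((range (legs m).length).filter fun j => legCube m j = k).card) ≤ L)
    {ρ : P → ℝ} (hρ : ∀ p, 0 ≤ ρ p) {ρ₀ ρ₁ : ℝ} (hρ₀ : ∀ k, (∑ p ∈ univ.filter (fun p => sees p k), ρ p) ≤ ρ₀)
    (hρ₁ : ∀ k, (∑ p ∈ univ.filter (fun p => sees p k), ρ p * (reach p k).card) ≤ ρ₁) :
    (∀ u ∈ Dir, (∑ p ∈ univ.filter (fun p => Cov p *ᵥ u ≠ 0), ρ p) ≤ ρ₀) ∧
    (∀ u ∈ Dir, (∑ p, ρ p *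
      ((∑ m, ((range (legs m).length).filter fun j => (Cov p *ᵥ u) ⬝ᵥ (legs m).getD j 0 ≠ 0).card : ℕ) : ℝ))
        ≤ L * ρ₁) := by
  constructor
  · intro u hu
    obtain ⟨k, hk⟩ := hDir u hu
    have hsub : univ.filter (fun p => Cov p *ᵥ u ≠ 0) ⊆ univ.filter fun p => sees p k := fun p hp => by
      rw [Finset.mem_filter] at hp ⊢
      exact ⟨hp.1, hin p u k hk hp.2⟩
    exact (Finset.sum_le_sum_of_subset_of_nonneg hsub fun p _ _ => hρ p).trans (hρ₀ k)
  · intro u hu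
    obtain ⟨k, hk⟩ := hDir u hu
    have hz : ∀ p, Cov p *ᵥ u = 0 →
        (∑ m, ((range (legs m).length).filter fun j => (Cov p *ᵥ u) ⬝ᵥ (legs m).getD j 0 ≠ 0).card) = 0 :=
      fun p hp => Finset.sum_eq_zero fun m _ => by
        rw [Finset.card_eq_zero, Finset.filter_eq_empty_iff]
        intro j _ h
        exact h (by rw [hp, zero_dotProduct])
    calc ∑ p, ρ p * ((∑ m, ((range (legs m).length).filter
            fun j => (Cov p *ᵥ u) ⬝ᵥ (legs m).getD j 0 ≠ 0).card : ℕ) : ℝ)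
        = ∑ p ∈ univ.filter (fun p => Cov p *ᵥ u ≠ 0), ρ p * ((∑ m, ((range (legs m).length).filter
            fun j => (Cov p *ᵥ u) ⬝ᵥ (legs m).getD j 0 ≠ 0).card : ℕ) : ℝ) := by
          rw [Finset.sum_filter]
          refine Finset.sum_congr rfl fun p _ => ?_
          by_cases hp : Cov p *ᵥ u = 0
          · rw [if_neg (not_not.2 hp), hz p hp, Nat.cast_zero, mul_zero]
          · rw [if_pos hp]
      _ ≤ ∑ p ∈ univ.filter (fun p => Cov p *ᵥ u ≠ 0), ρ p * ((L : ℝ) * (reach p k).card) :=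
          Finset.sum_le_sum fun p _ => mul_le_mul_of_nonneg_left
            (by exact_mod_cast coupled_legs_le_of_support hleg hL (reach p k) (hout p u k hk)) (hρ p)
      _ ≤ ∑ p ∈ univ.filter (fun p => sees p k), ρ p * ((L : ℝ) * (reach p k).card) :=
          Finset.sum_le_sum_of_subset_of_nonneg (fun p hp => by
              rw [Finset.mem_filter] at hp ⊢
              exact ⟨hp.1, hin p u k hk hp.2⟩)
            fun p _ _ => mul_nonneg (hρ p) (mul_nonneg (Nat.cast_nonneg _) (Nat.cast_nonneg _))
      _ = (L : ℝ) * ∑ p ∈ univ.filter (fun p => sees p k), ρ p * (reach p k).card := by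
          rw [Finset.mul_sum]
          exact Finset.sum_congr rfl fun p _ => by ring
      _ ≤ L * ρ₁ := mul_le_mul_of_nonneg_left (hρ₁ k) (Nat.cast_nonneg _)

end Literature.MathematicalPhysics.QuantumFieldTheory.BalabanImbrieJaffe1984to88.BIJ88WalkWeightedLocalitySupports

end
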